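import Literature.NumberTheory.EllipticCurves.IwasawaAlgebraEisensteinQuotientDVRProofs
import Literature.NumberTheory.EllipticCurves.IwasawaAlgebraSpecializationTorsionBoundProofs
import HarnessLib

/-!
# (H-i) of the K2 stub from ONE Eisenstein specialisation: a finitely generated torsion-free `Λ`-module that is
# cyclic modulo one `q_m = T^m + p` (`m ≥ 1`) — e.g. because it injects modulo `q_m` into a free rank-one
# `S_m = Λ/(q_m)`-module — is free of rank one over `Λ`

Support algebra for crux stmt-BirchSwinnertonDyer-24737 `UniversalToricDescent.TwinAlgMuZeroAtThree`, line `beta-road`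
(skeleton v9, K2 stub `stub_howardOutputsOfFamily`, conjunct (H-i) «`𝔖 ≅ Λ`»; LEAD bsd-wall-utd-p1 g24). In Howard's
proof of Thm. 2.2.10 the freeness of the `Λ`-adic Selmer module `𝔖` is read off the DVR specialisations: Thm. 1.6.1 (i)
makes `H¹_F(K, T ⊗ S_𝔮)` free of rank one over the discrete valuation ring `S_𝔮 = Λ/𝔮`, control embeds `𝔖/𝔮𝔖` into
it, so `𝔖/𝔮𝔖` is cyclic, and Nakayama (`𝔮 ⊂ 𝔪_Λ`) with torsion-freeness gives `𝔖 ≅ Λ`. This file proves that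
bookkeeping ONCE, generically, so that conjunct (H-i) of the stub costs exactly ONE specialisation `q_m`, `m ≥ 1`:

* §1 `span_singleton_eq_top_of_forall_sub_smul_mem` — Nakayama over a local ring `R`: `M` finitely generated,
  `a ∈ 𝔪_R`, `M/aM` generated by the class of `s` ⟹ `M = R∙s`.
* §2 `nonempty_linearEquiv_of_span_singleton_eq_top` — over a domain, a torsion-free cyclic non-zero module is
  free of rank one (`M ≃ₗ[R] R`).
* §3 `exists_forall_sub_smul_mem_of_ker_le` — the specialisation side, generic: `I ≤ R` with `R/I` a principal
  ideal ring, `H` an `R/I`-module with `H ≃ₗ[R/I] R/I`, `f : S →ₗ[R] H` with `ker f ≤ I•S` ⟹ `S/IS` is cyclic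
  (the `R/I`-span of the image of `f` is a principal submodule of `H ≅ R/I`; its generator lifts along `f`).
* §4 the assembly over `Λ = ℤ_p⟦T⟧` at `q_m` (`IwasawaAlgebra.X_pow_add_C_mem_maximalIdeal`,
  `IwasawaAlgebra.isDiscreteValuationRing_quotient_X_pow_add_C`): **`nonempty_linearEquiv_of_cyclic_specialization`**
  (cyclic modulo one `q_m` ⟹ `S ≃ₗ[Λ] Λ`) and **`nonempty_linearEquiv_of_specialization`** (an injective-modulo-`q_m`
  `Λ`-linear map into a free rank-one `Λ/(q_m)`-module ⟹ `S ≃ₗ[Λ] Λ`), plus the form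
  `…_of_bijective_toSpanSingleton` matching the generator currency of
  `Howard2004.DVRSetting.Conclusion` / `HeegnerMuPartStabilized.nonempty_specWitness_of_dvrConclusion` (cell x9).

THEOREMS ONLY; no `sorry`, no definition, no named fact; imports no `Theses` module. Nothing about Selmer groups is
asserted; BSD is not proved by any of this. References: B. Howard, Compositio Math. 140 (2004), Thm. 1.6.1 (i) and
proof of Thm. 2.2.10 (𝔮 = T^m + p); L. Washington, GTM 83, §13.3 (Nakayama for Λ); N. Bourbaki, AC II §3 no. 2.
-/

set_option linter.dupNamespace false
set_option autoImplicit false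

noncomputable section

open scoped Classical

namespace Summit.BirchSwinnertonDyer.BirchSwinnertonDyer.Theorems.UniversalToricDescentFreeOfCyclicSpecialization

open Literature.NumberTheory.EllipticCurves

/-! ## §1 Nakayama: cyclic modulo an element of the maximal ideal ⟹ cyclic -/

section Nakayama

variable {R : Type*} [CommRing R] [IsLocalRing R] {M : Type*} [AddCommGroup M] [Module R M]

/-- **Nakayama, cyclic form**: `R` local, `a ∈ 𝔪_R`, `M` finitely generated; if every `x ∈ M` is congruent to a
multiple of `s` modulo `a•M`, then `M = R∙s`. [cite: Washington1997, §13.3 Lemma 13.16] [cite: BourbakiAC5to7, Ch. II §3 no. 2 Cor. 2 of Prop. 4] -/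
theorem span_singleton_eq_top_of_forall_sub_smul_mem [Module.Finite R M] {a : R}
    (ha : a ∈ IsLocalRing.maximalIdeal R) (s : M)
    (hs : ∀ x : M, ∃ r : R, x - r • s ∈ (Ideal.span {a} : Ideal R) • (⊤ : Submodule R M)) :
    Submodule.span R {s} = ⊤ := by
  have hjac : (Ideal.span {a} : Ideal R) ≤ (⊥ : Ideal R).jacobson := by
    rw [IsLocalRing.jacobson_eq_maximalIdeal ⊥ bot_ne_top, Ideal.span_le, Set.singleton_subset_iff]
    exact ha
  refine top_le_iff.mp (Submodule.le_of_le_smul_of_le_jacobson_bot Module.Finite.fg_top hjac ?_)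
  intro x _
  obtain ⟨r, hr⟩ := hs x
  have hx : x = r • s + (x - r • s) := by abel
  rw [hx]
  exact Submodule.add_mem_sup (Submodule.smul_mem _ r (Submodule.mem_span_singleton_self s)) hr

end Nakayama

/-! ## §2 A torsion-free cyclic non-zero module over a domain is free of rank one -/

section FreeRankOne

variable {R : Type*} [CommRing R] [IsDomain R] {M : Type*} [AddCommGroup M] [Module R M]
  [NoZeroSMulDivisors R M]

/-- `M = R∙s` with `s ≠ 0` and `M` torsion-free over a domain ⟹ `M ≃ₗ[R] R` (`r ↦ r•s` is bijective).
[cite: BourbakiAC5to7, Ch. II §3 no. 2 Prop. 5] -/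
theorem nonempty_linearEquiv_of_span_singleton_eq_top {s : M} (hs : Submodule.span R {s} = ⊤) (hs0 : s ≠ 0) :
    Nonempty (M ≃ₗ[R] R) :=
  ⟨((LinearEquiv.toSpanNonzeroSingleton R M s hs0).trans (LinearEquiv.ofTop _ hs)).symm⟩

/-- The same with `s ≠ 0` read off `M ≠ 0`. [cite: BourbakiAC5to7, Ch. II §3 no. 2 Prop. 5] -/
theorem nonempty_linearEquiv_of_span_singleton_eq_top' [Nontrivial M] {s : M}
    (hs : Submodule.span R {s} = ⊤) : Nonempty (M ≃ₗ[R] R) := by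
  refine nonempty_linearEquiv_of_span_singleton_eq_top hs fun h0 => ?_
  rw [h0, Submodule.span_singleton_eq_bot.mpr rfl] at hs
  exact bot_ne_top hs

end FreeRankOne

/-! ## §3 The specialisation side: injecting modulo `I` into a free rank-one `R/I`-module, `R/I` principal -/

section Specialization

variable {R : Type*} [CommRing R] (I : Ideal R)
  {S : Type*} [AddCommGroup S] [Module R S]
  {H : Type*} [AddCommGroup H] [Module R H] [Module (R ⧸ I) H] [IsScalarTower R (R ⧸ I) H]

/-- **`S/IS` is cyclic** when `S` maps `R`-linearly, injectively modulo `I•S`, into an `R/I`-module `H ≅ R/I` and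
`R/I` is a principal ideal ring: the `R/I`-span of the image is principal, and a generator lifts along `f`.
(Howard: `𝔖/𝔮𝔖 ↪ H¹_F(K, T_𝔮) ≅ S_𝔮`, `S_𝔮` a DVR.) [cite: Howard2004HeegnerKolyvagin, proof of Thm. 2.2.10 (𝔮 = T^m + p) with Thm. 1.6.1 (i)] -/
theorem exists_forall_sub_smul_mem_of_ker_le [IsPrincipalIdealRing (R ⧸ I)] (e : H ≃ₗ[R ⧸ I] (R ⧸ I))
    (f : S →ₗ[R] H) (hker : LinearMap.ker f ≤ I • (⊤ : Submodule R S)) :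
    ∃ s : S, ∀ x : S, ∃ r : R, x - r • s ∈ I • (⊤ : Submodule R S) := by
  -- the `R/I`-span of the image of `f` has the same elements as `range f`
  set N : Submodule (R ⧸ I) H := Submodule.span (R ⧸ I) (Set.range f) with hN
  have hNR : ∀ y : H, y ∈ N ↔ y ∈ LinearMap.range f := by
    intro y
    have h1 : (N.restrictScalars R : Submodule R H) = LinearMap.range f := by
      rw [hN, Submodule.restrictScalars_span R (R ⧸ I) Ideal.Quotient.mk_surjective (Set.range f),
        ← LinearMap.coe_range, Submodule.span_eq]
    rw [← h1, Submodule.restrictScalars_mem]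
  -- it is principal, `H ≅ R/I` being cyclic over the principal ideal ring `R/I`
  obtain ⟨t', ht'⟩ := (IsPrincipalIdealRing.principal (N.map (e : H →ₗ[R ⧸ I] R ⧸ I))).principal
  have htN : e.symm t' ∈ N := by
    have ht'mem : t' ∈ N.map (e : H →ₗ[R ⧸ I] R ⧸ I) := by
      rw [ht']; exact Submodule.mem_span_singleton_self _
    obtain ⟨y, hy, hyt⟩ := Submodule.mem_map.mp ht'mem
    have hy' : y = e.symm t' := by
      rw [LinearEquiv.eq_symm_apply]; exact hyt
    exact hy' ▸ hy
  obtain ⟨s, hs⟩ := (hNR _).mp htN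
  refine ⟨s, fun x => ?_⟩
  have hxN : e (f x) ∈ N.map (e : H →ₗ[R ⧸ I] R ⧸ I) :=
    Submodule.mem_map_of_mem ((hNR _).mpr ⟨x, rfl⟩)
  rw [ht', Submodule.mem_span_singleton] at hxN
  obtain ⟨c, hc⟩ := hxN
  obtain ⟨r, rfl⟩ := Ideal.Quotient.mk_surjective c
  refine ⟨r, hker ?_⟩
  rw [LinearMap.mem_ker, map_sub, map_smul, hs, sub_eq_zero]
  apply e.injective
  rw [← hc, ← algebraMap_smul (R ⧸ I) r (e.symm t'), map_smul, LinearEquiv.apply_symm_apply,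
    Ideal.Quotient.algebraMap_eq]

/-- The same with the freeness of `H` given by a bijective `x₀ ↦`-span map (the currency of
`Howard2004.DVRSetting.Conclusion` (i) / `HeegnerMuPartStabilized.nonempty_specWitness_of_dvrConclusion`).
[cite: Howard2004HeegnerKolyvagin, Thm. 1.6.1 (i) and proof of Thm. 2.2.10] -/
theorem exists_forall_sub_smul_mem_of_ker_le_of_bijective [IsPrincipalIdealRing (R ⧸ I)] (x₀ : H)
    (hx₀ : Function.Bijective (LinearMap.toSpanSingleton (R ⧸ I) H x₀))
    (f : S →ₗ[R] H) (hker : LinearMap.ker f ≤ I • (⊤ : Submodule R S)) :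
    ∃ s : S, ∀ x : S, ∃ r : R, x - r • s ∈ I • (⊤ : Submodule R S) :=
  exists_forall_sub_smul_mem_of_ker_le I (LinearEquiv.ofBijective _ hx₀).symm f hker

end Specialization

/-! ## §4 Assembly over `Λ = ℤ_p⟦T⟧` at Howard's Eisenstein prime `q_m = T^m + p` -/

section Iwasawa

variable {p : ℕ} [Fact p.Prime]
  {S : Type*} [AddCommGroup S] [Module (IwasawaAlgebra p) S]

/-- **(H-i) from ONE cyclic specialisation**: `S` finitely generated and torsion-free over `Λ`, `S ≠ 0`, and `S/q_mS`
cyclic for ONE `m ≥ 1` ⟹ `S ≃ₗ[Λ] Λ`. [cite: Howard2004HeegnerKolyvagin, proof of Thm. 2.2.10 (𝔮 = T^m + p)] [cite: Washington1997, §13.3 Lemma 13.16] -/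
theorem nonempty_linearEquiv_of_cyclic_specialization [Module.Finite (IwasawaAlgebra p) S]
    [NoZeroSMulDivisors (IwasawaAlgebra p) S] [Nontrivial S] {m : ℕ} (hm : 1 ≤ m) (s : S)
    (hs : ∀ x : S, ∃ r : IwasawaAlgebra p, x - r • s ∈
      (Ideal.span {(PowerSeries.X ^ m + PowerSeries.C (p : ℤ_[p]) : IwasawaAlgebra p)} :
        Ideal (IwasawaAlgebra p)) • (⊤ : Submodule (IwasawaAlgebra p) S)) :
    Nonempty (S ≃ₗ[IwasawaAlgebra p] IwasawaAlgebra p) :=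
  nonempty_linearEquiv_of_span_singleton_eq_top'
    (span_singleton_eq_top_of_forall_sub_smul_mem (IwasawaAlgebra.X_pow_add_C_mem_maximalIdeal p hm) s hs)

/-- **(H-i) from ONE specialisation into a free rank-one `S_m`-module**: `S` finitely generated, torsion-free,
non-zero over `Λ`; for ONE `m ≥ 1` a `Λ`-linear map `f : S → H` into an `S_m = Λ/(q_m)`-module `H ≃ₗ[S_m] S_m`,
injective modulo `q_m S` (`ker f ≤ q_m • S`) ⟹ `S ≃ₗ[Λ] Λ`. With `H = H¹_F(K, T ⊗ S_m)` free of rank one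
(Howard Thm. 1.6.1 (i)) and `f` the control map this is the freeness of `𝔖` in the proof of Thm. 2.2.10.
[cite: Howard2004HeegnerKolyvagin, Thm. 1.6.1 (i) and proof of Thm. 2.2.10 (𝔮 = T^m + p)] -/
theorem nonempty_linearEquiv_of_specialization [Module.Finite (IwasawaAlgebra p) S]
    [NoZeroSMulDivisors (IwasawaAlgebra p) S] [Nontrivial S] {m : ℕ} (hm : 1 ≤ m)
    {H : Type*} [AddCommGroup H] [Module (IwasawaAlgebra p) H]
    [Module (IwasawaAlgebra p ⧸
      Ideal.span {(PowerSeries.X ^ m + PowerSeries.C (p : ℤ_[p]) : IwasawaAlgebra p)}) H]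
    [IsScalarTower (IwasawaAlgebra p) (IwasawaAlgebra p ⧸
      Ideal.span {(PowerSeries.X ^ m + PowerSeries.C (p : ℤ_[p]) : IwasawaAlgebra p)}) H]
    (e : H ≃ₗ[IwasawaAlgebra p ⧸
      Ideal.span {(PowerSeries.X ^ m + PowerSeries.C (p : ℤ_[p]) : IwasawaAlgebra p)}]
      (IwasawaAlgebra p ⧸
        Ideal.span {(PowerSeries.X ^ m + PowerSeries.C (p : ℤ_[p]) : IwasawaAlgebra p)}))
    (f : S →ₗ[IwasawaAlgebra p] H)
    (hker : LinearMap.ker f ≤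
      (Ideal.span {(PowerSeries.X ^ m + PowerSeries.C (p : ℤ_[p]) : IwasawaAlgebra p)} :
        Ideal (IwasawaAlgebra p)) • (⊤ : Submodule (IwasawaAlgebra p) S)) :
    Nonempty (S ≃ₗ[IwasawaAlgebra p] IwasawaAlgebra p) := by
  letI := IwasawaAlgebra.isDomain_quotient_X_pow_add_C p hm
  letI := IwasawaAlgebra.isDiscreteValuationRing_quotient_X_pow_add_C p hm
  obtain ⟨s, hs⟩ := exists_forall_sub_smul_mem_of_ker_le _ e f hker
  exact nonempty_linearEquiv_of_cyclic_specialization hm s hs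

/-- The same in the generator currency of `Howard2004.DVRSetting.Conclusion` (i): `H = S_m ∙ x₀` bijectively.
[cite: Howard2004HeegnerKolyvagin, Thm. 1.6.1 (i) and proof of Thm. 2.2.10 (𝔮 = T^m + p)] -/
theorem nonempty_linearEquiv_of_specialization_of_bijective_toSpanSingleton
    [Module.Finite (IwasawaAlgebra p) S] [NoZeroSMulDivisors (IwasawaAlgebra p) S] [Nontrivial S]
    {m : ℕ} (hm : 1 ≤ m)
    {H : Type*} [AddCommGroup H] [Module (IwasawaAlgebra p) H]
    [Module (IwasawaAlgebra p ⧸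
      Ideal.span {(PowerSeries.X ^ m + PowerSeries.C (p : ℤ_[p]) : IwasawaAlgebra p)}) H]
    [IsScalarTower (IwasawaAlgebra p) (IwasawaAlgebra p ⧸
      Ideal.span {(PowerSeries.X ^ m + PowerSeries.C (p : ℤ_[p]) : IwasawaAlgebra p)}) H]
    (x₀ : H) (hx₀ : Function.Bijective (LinearMap.toSpanSingleton (IwasawaAlgebra p ⧸
      Ideal.span {(PowerSeries.X ^ m + PowerSeries.C (p : ℤ_[p]) : IwasawaAlgebra p)}) H x₀))
    (f : S →ₗ[IwasawaAlgebra p] H)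
    (hker : LinearMap.ker f ≤
      (Ideal.span {(PowerSeries.X ^ m + PowerSeries.C (p : ℤ_[p]) : IwasawaAlgebra p)} :
        Ideal (IwasawaAlgebra p)) • (⊤ : Submodule (IwasawaAlgebra p) S)) :
    Nonempty (S ≃ₗ[IwasawaAlgebra p] IwasawaAlgebra p) :=
  nonempty_linearEquiv_of_specialization hm (LinearEquiv.ofBijective _ hx₀).symm f hker

/-- Consequence in the K2 stub's currency: `finrank_Λ S = 1`. [cite: Howard2004HeegnerKolyvagin, Thm. B (i) / Thm. 2.2.10] -/
theorem finrank_eq_one_of_cyclic_specialization [Module.Finite (IwasawaAlgebra p) S]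
    [NoZeroSMulDivisors (IwasawaAlgebra p) S] [Nontrivial S] {m : ℕ} (hm : 1 ≤ m) (s : S)
    (hs : ∀ x : S, ∃ r : IwasawaAlgebra p, x - r • s ∈
      (Ideal.span {(PowerSeries.X ^ m + PowerSeries.C (p : ℤ_[p]) : IwasawaAlgebra p)} :
        Ideal (IwasawaAlgebra p)) • (⊤ : Submodule (IwasawaAlgebra p) S)) :
    Module.finrank (IwasawaAlgebra p) S = 1 := by
  obtain ⟨e⟩ := nonempty_linearEquiv_of_cyclic_specialization hm s hs
  rw [LinearEquiv.finrank_eq e, Module.finrank_self]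

end Iwasawa

end Summit.BirchSwinnertonDyer.BirchSwinnertonDyer.Theorems.UniversalToricDescentFreeOfCyclicSpecialization

end
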